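import Summits.BirchSwinnertonDyer.BirchSwinnertonDyer.Theorems.ManinLocalTwoThreeTameThreeIstarZeroTorsion
import Summits.BirchSwinnertonDyer.BirchSwinnertonDyer.Theorems.ManinLocalTwoThreeIstarJValuation
import Summits.BirchSwinnertonDyer.BirchSwinnertonDyer.Theorems.ManinLocalTwoThreeNoAscendingTamePotGoodThree
import Summits.BirchSwinnertonDyer.BirchSwinnertonDyer.Theorems.ManinLocalTwoThreeTameThreeTorsionCongruence
import HarnessLib

/-!
# The tripling profile at `N = 9p` on the `I₀*` stratum (`W₀`, `W₁` both `I₀*`, Vélu line with `ord₃ D₀ = 3`), and tame `I₀*` is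
# potentially good (`3² ∣ c₄`, `ord₃ j ≥ 0`)

Summit `BirchSwinnertonDyer`, route `ManinLocalTwoThree` (cell bsd-f2-manin), deciding crux C3 `ManinPrimeToThreeAtNine`
(stmt-BirchSwinnertonDyer-22968).  p3-g6's `velu_three_of_tripled_nine_mul_prime` (tripled `|c₀| = 3|c₁|` at `9p` ⟹ `W₁` carries the `u = 1`
Vélu `3`-pair of `W₀` at a rational `3`-LINE `q`) + p645802's bookkeeping (`ord₃ Δ_min(W₁) + 4·ord₃ D₀ = 18` on `I₀*`) + p652435's local
dichotomy on `I₀*` (`ord₃ D₀ = 0 ∧ (A = 0 ∨ ord₃ A ≥ 4)`, or `ord₃ D₀ ≥ 3`) + the tame classification for `W₁` (`9 ∥ N(W₁)` by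
`exists_isNewformOf`) + p651737 (`I₁₂*` has `ord₃ j = −12`, against `j(W₁) = A³/Δ(W₁)`, the lead's `padicValRat_three_j_eq`):

* `padicValRat_three_c₄_of_IstarZero`, `padicValRat_three_j_nonneg_of_IstarZero` — a globally minimal `W` with `9 ∥ N`, `ord₃ Δ_min = 6` has
  `c₄ = 0 ∨ ord₃ c₄ ≥ 2` (normal form `c₄ = 9(B₂² − 24B₄)`, `‖u‖₃ = 1`), hence `ord₃ j ≥ 0`: tame `I₀*` is potentially good.
* `tripling_profile_IstarZero_nine_mul_prime` — `|c₀| = 3|c₁|`, `ord₃ Δ_min(W₀) = 6` ⟹ `ord₃ Δ_min(W₁) = 6` and the Vélu line has `ord₃ D₀ = 3`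
  (E-an-109's `u = 1` branch; the branch `ord₃ D₀ = 0` would make `W₁` of type `I₁₂*`).
* `tripling_profile_potGood_nine_mul_prime'` — tripled ∧ `ord₃ j(W₀) ≥ 0` ⟹ (`W₀` `III`, `W₁` `III*`) ∨ (`W₀`, `W₁` both `I₀*`).

(For rational `3`-torsion POINTS on the tame band the lead's `…TameThreeTorsionAscends` (17:29Z) proves the ascent unconditionally; this file
concerns the Γ₀/Γ₁ tripling ledger, where the kernel is a rational LINE.)  HONEST FRAMING: C3, Manin's conjecture and BSD are not proved;
whether tripling happens on `I₀*` is global.  No definitions, no named facts, no sorry.  References: [CesnaviciusNeururerSaha2023] Lemma 6.5;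
[SilvermanATAEC1994] IV.9.4 Step 6, Table 4.1; [DokchitserDokchitser2015LocalInvariants] Table 1; HOME/MEMO-an.md §66 (E-an-109).
-/

set_option linter.dupNamespace false
set_option autoImplicit false

noncomputable section

open scoped Classical

open WeierstrassCurve Polynomial CongruenceSubgroup IsLocalRing
  Literature.NumberTheory.DiophantineGeometry Literature.NumberTheory.DiophantineGeometry.TateAlgorithm
  Literature.NumberTheory.EllipticCurves Literature.NumberTheory.EllipticCurves.ModularForms
  Summit.BirchSwinnertonDyer.Rank1Residual.Additive

namespace Summit.BirchSwinnertonDyer.BirchSwinnertonDyer.Theorems.ManinLocalTwoThree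

/-! ### §1 `3² ∣ c₄` and `ord₃ j ≥ 0` on tame `I₀*` -/

/-- **`3² ∣ c₄` on tame `I₀*`:** `W` globally minimal, `9 ∥ N`, `ord₃ Δ_min = 6` ⟹ `c₄(W) = 0` or `ord₃ c₄(W) ≥ 2`.
[cite: SilvermanATAEC1994, IV.9.4 Step 6] -/
theorem padicValRat_three_c₄_of_IstarZero (W : WeierstrassCurve ℚ) [W.IsElliptic] [W.IsGloballyMinimal]
    (h9 : 3 ^ 2 ∣ W.conductorNorm ℤ) (h27 : ¬ 3 ^ 3 ∣ W.conductorNorm ℤ) (hΔ6 : padicValInt 3 W.minimalDiscriminantInt = 6) :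
    W.c₄ = 0 ∨ 2 ≤ padicValRat 3 W.c₄ := by
  haveI : Fact (Nat.Prime 3) := ⟨Nat.prime_three⟩
  have hKp := kodairaSymbolOfMinimal_padicThree_eq_Istar_zero W h9 h27 hΔ6
  set X : WeierstrassCurve ℚ_[3] := W.baseChange ℚ_[3] with hX
  set V₀ : WeierstrassCurve ℤ_[3] := (X.minimal ℤ_[3]).integralModel ℤ_[3] with hV₀
  set E : WeierstrassCurve.VariableChange ℚ_[3] := (X.exists_isMinimal ℤ_[3]).choose with hE
  have hmin : X.minimal ℤ_[3] = E • X := rfl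
  have hV₀X : V₀.baseChange ℚ_[3] = X.minimal ℤ_[3] := WeierstrassCurve.baseChange_integralModel_eq ℤ_[3] _
  have halg : algebraMap ℤ_[3] ℚ_[3] = PadicInt.Coe.ringHom := rfl
  have hrat : ∀ r : ℚ, algebraMap ℚ ℚ_[3] r = (r : ℚ_[3]) := fun r => by rw [eq_ratCast]
  have hXc₄ : X.c₄ = (W.c₄ : ℚ_[3]) := by rw [hX, WeierstrassCurve.baseChange, map_c₄, hrat]
  have hXΔ : X.Δ = (W.Δ : ℚ_[3]) := by rw [hX, WeierstrassCurve.baseChange, map_Δ, hrat]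
  haveI : X.IsMinimal ℤ_[3] := isMinimal_baseChange_padic_of_isGloballyMinimal' W 3
  have hXΔ0 : X.Δ ≠ 0 := by
    rw [hXΔ]; exact_mod_cast (show W.Δ ≠ 0 by rw [← WeierstrassCurve.coe_Δ']; exact W.Δ'.ne_zero)
  have hminΔ : (X.minimal ℤ_[3]).Δ ≠ 0 := by
    rw [hmin, variableChange_Δ]; exact mul_ne_zero (pow_ne_zero _ (Units.ne_zero _)) hXΔ0
  have hV₀Δc : ((V₀.Δ : ℤ_[3]) : ℚ_[3]) = (X.minimal ℤ_[3]).Δ := by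
    rw [← hV₀X, WeierstrassCurve.baseChange, map_Δ, halg]; rfl
  have hV₀Δ : V₀.Δ ≠ 0 := fun h ↦ hminΔ (by rw [← hV₀Δc, h]; rfl)
  obtain ⟨D, α₁, α₂, α₃, α₄, α₆, h₁, h₂, h₃, h₄, h₆⟩ := exists_IstarZeroNormalForm_padicInt_three V₀ hV₀Δ hKp
  set Ctot : WeierstrassCurve.VariableChange ℚ_[3] := D.map (algebraMap ℤ_[3] ℚ_[3]) * E with hCtot
  have hCX : Ctot • X = (D • V₀).map (algebraMap ℤ_[3] ℚ_[3]) := by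
    rw [hCtot, mul_smul, ← hmin, ← hV₀X]
    exact WeierstrassCurve.map_variableChange _ _ _
  obtain ⟨-, -, -, -, hc₄NF⟩ := map_b_of_IstarZeroNormalForm (D • V₀) h₁ h₂ h₃ h₄ h₆
  -- `‖u‖ = 1`
  have hnormmin : ‖(X.minimal ℤ_[3]).Δ‖ = ‖X.Δ‖ := by
    rw [Padic.norm_eq_zpow_neg_valuation hminΔ, Padic.norm_eq_zpow_neg_valuation hXΔ0, padicValuation_Δ_minimal_eq X hXΔ0]
  have hΔNF : (Ctot • X).Δ = ((((D.u⁻¹ : ℤ_[3]ˣ) : ℤ_[3]) ^ 12 * V₀.Δ : ℤ_[3]) : ℚ_[3]) := by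
    rw [hCX, map_Δ, variableChange_Δ, halg]; rfl
  have hnormNF : ‖(Ctot • X).Δ‖ = ‖X.Δ‖ := by
    rw [hΔNF]; push_cast
    rw [norm_mul, norm_pow, hV₀Δc, hnormmin]
    have hDu : ‖(((D.u⁻¹ : ℤ_[3]ˣ) : ℤ_[3]) : ℚ_[3])‖ = 1 := by
      rw [← PadicInt.norm_def]; exact PadicInt.isUnit_iff.mp (Units.isUnit _)
    rw [hDu, one_pow, one_mul]
  have hun : ‖((Ctot.u⁻¹ : ℚ_[3]ˣ) : ℚ_[3])‖ = 1 := by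
    have h := hnormNF
    rw [variableChange_Δ, norm_mul, norm_pow] at h
    have hX0 : ‖X.Δ‖ ≠ 0 := norm_ne_zero_iff.mpr hXΔ0
    have h12 : ‖((Ctot.u⁻¹ : ℚ_[3]ˣ) : ℚ_[3])‖ ^ 12 = 1 := mul_right_cancel₀ hX0 (h.trans (one_mul _).symm)
    exact (pow_eq_one_iff_of_nonneg (norm_nonneg _) (by norm_num)).mp h12
  -- `c₄(X) = u⁴·c₄(NF)`, `c₄(NF) = 9·(…)`
  have hc₄X : ((Ctot.u⁻¹ : ℚ_[3]ˣ) : ℚ_[3]) ^ 4 * (W.c₄ : ℚ_[3]) = ((D • V₀).map PadicInt.Coe.ringHom).c₄ := by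
    rw [← halg, ← hCX, variableChange_c₄, hXc₄]
  have h3n : ‖(3 : ℚ_[3])‖ = 3⁻¹ := by have := Padic.norm_p (p := 3); exact_mod_cast this
  have hm1 : ∀ m : ℤ_[3], ‖(m : ℚ_[3])‖ ≤ 1 := fun m => by rw [← PadicInt.norm_def]; exact PadicInt.norm_le_one m
  have c2 : ((2 : ℤ_[3]) : ℚ_[3]) = 2 := by exact_mod_cast PadicInt.coe_natCast 2
  have c3 : ((3 : ℤ_[3]) : ℚ_[3]) = 3 := by exact_mod_cast PadicInt.coe_natCast 3
  have c4 : ((4 : ℤ_[3]) : ℚ_[3]) = 4 := by exact_mod_cast PadicInt.coe_natCast 4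
  have c24 : ((24 : ℤ_[3]) : ℚ_[3]) = 24 := by exact_mod_cast PadicInt.coe_natCast 24
  have hint : ‖((((3 * α₁ ^ 2 + 4 * α₂) ^ 2 : ℤ_[3]) : ℚ_[3]) - 24 * (((2 * α₄ + 3 * α₁ * α₃) : ℤ_[3]) : ℚ_[3]))‖ ≤ 1 := by
    have e : ((((3 * α₁ ^ 2 + 4 * α₂) ^ 2 : ℤ_[3]) : ℚ_[3]) - 24 * (((2 * α₄ + 3 * α₁ * α₃) : ℤ_[3]) : ℚ_[3])) =
        ((((3 * α₁ ^ 2 + 4 * α₂) ^ 2 - 24 * (2 * α₄ + 3 * α₁ * α₃) : ℤ_[3])) : ℚ_[3]) := by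
      push_cast; simp only [c2, c3, c4, c24]
    rw [e]; exact hm1 _
  have hnc₄ : ‖(W.c₄ : ℚ_[3])‖ ≤ 3⁻¹ ^ 2 := by
    have h := congrArg (‖·‖) hc₄X
    simp only [norm_mul, norm_pow, hun, one_pow, one_mul] at h
    rw [h, hc₄NF, norm_mul, show (9 : ℚ_[3]) = 3 ^ 2 by norm_num, norm_pow, h3n]
    exact mul_le_of_le_one_right (by positivity) hint
  by_cases hc0 : W.c₄ = 0
  · exact Or.inl hc0
  · right
    rw [Padic.eq_padicNorm, padicNorm.eq_zpow_of_nonzero hc0] at hnc₄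
    push_cast at hnc₄
    rw [show ((3 : ℝ)⁻¹) ^ 2 = (3 : ℝ) ^ (-2 : ℤ) by norm_num, zpow_le_zpow_iff_right₀ (by norm_num : (1 : ℝ) < 3)] at hnc₄
    omega

/-- **Tame `I₀*` is potentially good: `ord₃ j ≥ 0`** (`W` globally minimal, `9 ∥ N`, `ord₃ Δ_min = 6`).
[cite: SilvermanATAEC1994, IV.9.4 Step 6 and Table 4.1] -/
theorem padicValRat_three_j_nonneg_of_IstarZero (W : WeierstrassCurve ℚ) [W.IsElliptic] [W.IsGloballyMinimal]
    (h9 : 3 ^ 2 ∣ W.conductorNorm ℤ) (h27 : ¬ 3 ^ 3 ∣ W.conductorNorm ℤ) (hΔ6 : padicValInt 3 W.minimalDiscriminantInt = 6) :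
    0 ≤ padicValRat 3 W.j := by
  haveI : Fact (Nat.Prime 3) := ⟨Nat.prime_three⟩
  rcases padicValRat_three_c₄_of_IstarZero W h9 h27 hΔ6 with hc0 | hc2
  · have : W.j = 0 := by rw [WeierstrassCurve.j, hc0]; ring
    rw [this, padicValRat.zero]
  · rw [padicValRat_three_j_eq W (fun h ↦ by rw [h, padicValRat.zero] at hc2; norm_num at hc2), ← cast_minimalDiscriminantInt W,
      padicValRat.of_int, hΔ6]
    push_cast
    omega

/-! ### §2 The tripling profile on `I₀*` -/

variable {W₁ W₀ : WeierstrassCurve ℚ} [W₁.IsElliptic] [W₁.IsGloballyMinimal] [W₀.IsElliptic] [W₀.IsGloballyMinimal]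

/-- **The tripling profile on `I₀*` at `N = 9p`** (`p ≡ 2 (mod 3)` prime; `exists_isNewformOf`): `|c₀| = 3|c₁|` and `ord₃ Δ_min(W₀) = 6` ⟹
`ord₃ Δ_min(W₁) = 6`, and the Vélu line `q` of p3-g6's rigidity has `ord₃ D₀(q) = 3`.
[cite: CesnaviciusNeururerSaha2023, Lemma 6.5] [cite: SilvermanATAEC1994, IV.9.4 Table 4.1] -/
theorem tripling_profile_IstarZero_nine_mul_prime (hnf : exists_isNewformOf) {p : ℕ} (hp : p.Prime) (hp3 : p % 3 = 2)
    [NeZero (9 * p)] (D₁ : Gamma1ParametrizationData W₁ (9 * p)) (D₀ : ModularParametrizationData W₀ (9 * p))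
    (hiso : IsIsogenous W₁ W₀) (h₁ : D₁.IsOptimal)
    (h₀ : ∀ z ∈ D₀.L.lattice, ∃ w ∈ periodLattice D₀.f, z = D₀.c * w)
    (hΔ6 : padicValInt 3 W₀.minimalDiscriminantInt = 6) (htri : D₀.maninConstant.natAbs = 3 * D₁.maninConstant.natAbs) :
    padicValInt 3 W₁.minimalDiscriminantInt = 6 ∧
      ∃ q : ℚ, W₀.Ψ₃.eval (q - W₀.b₂ / 12) = 0 ∧ W₁.c₄ = 1440 * q ^ 2 - 9 * W₀.c₄ ∧
        W₁.c₆ = 60480 * q ^ 3 - 756 * W₀.c₄ * q - 27 * W₀.c₆ ∧ padicValRat 3 (W₀.Ψ₂Sq.eval (q - W₀.b₂ / 12)) = 3 := by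
  haveI : Fact (Nat.Prime 3) := ⟨Nat.prime_three⟩
  obtain ⟨h9, h27⟩ := nine_dvd_not_twentyseven_dvd_conductorNorm_of_level_nine_mul_prime hnf hp hp3 D₀
  have hN₁ : 9 * p = W₁.conductorNorm ℤ := IsNewformOf.level_eq_conductorNorm_of_exists_isNewformOf hnf D₁.isNewformOf
  have h9₁ : 3 ^ 2 ∣ W₁.conductorNorm ℤ := by rw [← hN₁]; exact ⟨p, by ring⟩
  have h27₁ : ¬ 3 ^ 3 ∣ W₁.conductorNorm ℤ := by
    rw [← hN₁]; intro h
    have h3 : 3 ∣ p := by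
      have h27' : 9 * 3 ∣ 9 * p := by simpa [show (3 : ℕ) ^ 3 = 9 * 3 by norm_num] using h
      exact Nat.dvd_of_mul_dvd_mul_left (by norm_num : 0 < 9) h27'
    have := (Nat.prime_dvd_prime_iff_eq Nat.prime_three hp).mp h3
    omega
  obtain ⟨q, hq, hc4, hc6, hbook⟩ := exists_tripling_profile_nine_mul_prime hp hp3 D₁ D₀ hiso h₁ h₀ htri
  have hb := hbook 3
  rw [hΔ6] at hb
  push_cast at hb
  have hclass := nine_dvd_conductorNorm_classification W₁ h9₁ h27₁
  rcases veluD₀_dichotomy_of_IstarZero_three W₀ h9 h27 hΔ6 q hq with ⟨hD0, hA⟩ | hD3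
  · -- `ord₃ D₀ = 0`: `W₁` would be `I₁₂*` with `ord₃ j = −12`, but `j(W₁) = A³/Δ(W₁)` with `ord₃ A ≥ 4` or `A = 0`
    exfalso
    rw [hD0] at hb
    have hδ₁ : padicValInt 3 W₁.minimalDiscriminantInt = 18 := by omega
    have hj : padicValRat 3 W₁.j = -12 := by
      rcases hclass with ⟨-, h⟩ | ⟨-, h⟩ | ⟨-, h⟩ | ⟨n, -, h, hjn⟩
      · omega
      · omega
      · omega
      · have hn : n = 11 := by omega
        subst hn; rw [hjn]; norm_num
    rcases hA with hA0 | hA4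
    · have hj0 : W₁.j = 0 := by rw [WeierstrassCurve.j, hc4, hA0]; ring
      rw [hj0, padicValRat.zero] at hj
      norm_num at hj
    · have hc₄ne : W₁.c₄ ≠ 0 := by
        intro h0
        rw [← hc4, h0, padicValRat.zero] at hA4
        norm_num at hA4
      rw [padicValRat_three_j_eq W₁ hc₄ne, hc4, ← cast_minimalDiscriminantInt W₁, padicValRat.of_int, hδ₁] at hj
      push_cast at hj
      omega
  · -- `ord₃ D₀ ≥ 3`: then `ord₃ Δ_min(W₁) = 18 − 4·ord₃ D₀ ≤ 6` is a tame value `≥ 3`, forcing `ord₃ D₀ = 3`, `ord₃ Δ_min(W₁) = 6`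
    have hδ₁3 : 3 ≤ padicValInt 3 W₁.minimalDiscriminantInt := by
      rcases hclass with ⟨-, h⟩ | ⟨-, h⟩ | ⟨-, h⟩ | ⟨n, -, h, -⟩ <;> omega
    have hD : padicValRat 3 (W₀.Ψ₂Sq.eval (q - W₀.b₂ / 12)) = 3 := by omega
    exact ⟨by omega, q, hq, hc4, hc6, hD⟩

/-- **The tripling profile at `N = 9p` for potentially good optimal curves, sharpened:** tripled ∧ `ord₃ j(W₀) ≥ 0` ⟹
(`ord₃ Δ_min(W₀) = 3 ∧ ord₃ Δ_min(W₁) = 9`) ∨ (`ord₃ Δ_min(W₀) = 6 ∧ ord₃ Δ_min(W₁) = 6`).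
[cite: CesnaviciusNeururerSaha2023, Lemma 6.5] [cite: SilvermanATAEC1994, IV.9.4 Table 4.1] -/
theorem tripling_profile_potGood_nine_mul_prime' (hnf : exists_isNewformOf) {p : ℕ} (hp : p.Prime) (hp3 : p % 3 = 2)
    [NeZero (9 * p)] (D₁ : Gamma1ParametrizationData W₁ (9 * p)) (D₀ : ModularParametrizationData W₀ (9 * p))
    (hiso : IsIsogenous W₁ W₀) (h₁ : D₁.IsOptimal)
    (h₀ : ∀ z ∈ D₀.L.lattice, ∃ w ∈ periodLattice D₀.f, z = D₀.c * w) (hj : 0 ≤ padicValRat 3 W₀.j)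
    (htri : D₀.maninConstant.natAbs = 3 * D₁.maninConstant.natAbs) :
    (padicValInt 3 W₀.minimalDiscriminantInt = 3 ∧ padicValInt 3 W₁.minimalDiscriminantInt = 9) ∨
      (padicValInt 3 W₀.minimalDiscriminantInt = 6 ∧ padicValInt 3 W₁.minimalDiscriminantInt = 6) := by
  rcases tripling_profile_potGood_nine_mul_prime hnf hp hp3 D₁ D₀ hiso h₁ h₀ hj htri with h | h6
  · exact Or.inl h
  · exact Or.inr ⟨h6, (tripling_profile_IstarZero_nine_mul_prime hnf hp hp3 D₁ D₀ hiso h₁ h₀ h6 htri).1⟩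

end Summit.BirchSwinnertonDyer.BirchSwinnertonDyer.Theorems.ManinLocalTwoThree

end
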